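import Mathlib.Analysis.Convex.Contractible
import Mathlib.Analysis.InnerProductSpace.PiL2
import Mathlib.Topology.Homotopy.Equiv
import HarnessLib

/-!
# Punctured Euclidean space: slit decomposition and homotopy equivalences

Elementary geometric input for the homology of `ℝⁿ ∖ {0}` and of spheres by Mayer–Vietoris
(A. Hatcher, *Algebraic Topology*, CUP 2002, §2.1 Ex. 2.18/Cor. 2.14 strategy, and proof of
Lemma 3.27 (2)), in the coordinate model `Literature.RVec n = (Fin n → ℝ)`:

* `Literature.punctured n = {v | v ≠ 0}`; the two open **slit sets** `Literature.slitUp k`, `Literature.slitDown k`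
  (`ℝᵏ⁺¹` minus the closed lower/upper half of the last axis) with
  `slitUp ∪ slitDown = punctured (k+1)`, `slitUp ∩ slitDown = {v | Fin.init v ≠ 0}`, both open,
  star-shaped, hence contractible (`contractibleSpace_slitUp/Down`);
* `Literature.slitInterHomotopyEquiv k : ↥(slitUp k ∩ slitDown k) ≃ₕ ↥(punctured k)` (forget the last
  coordinate);
* `Literature.complSingletonHomeomorph x : ℝⁿ ∖ {x} ≃ₜ punctured n`, and
  `Literature.complStarConvexHomotopyEquiv : ↥Kᶜ ≃ₕ ↥{x}ᶜ` for `K` bounded and star-shaped about `x ∈ K`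
  (radial push-out; Hatcher's "`ℝⁿ - A` deformation retracts onto a sphere");
* `Literature.sphereHomotopyEquivPunctured n : ↥(Metric.sphere 0 1 ⊆ EuclideanSpace ℝ (Fin n)) ≃ₕ ↥(punctured n)`
  (radial retraction).

All maps and homotopies are explicit straight-line constructions; everything is proved. [folklore]

## References

* A. Hatcher, *Algebraic Topology*, CUP 2002, §2.1–§2.2 and Lemma 3.27.
-/

noncomputable section

open Set unitInterval ContinuousMap

namespace Literature.AlgebraicTopology.SingularHomology

/-- `ℝⁿ` as the space of coordinate functions `Fin n → ℝ` (sup norm; a real normed space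
homeomorphic to `EuclideanSpace ℝ (Fin n)`). [folklore] -/
abbrev RVec (n : ℕ) : Type := Fin n → ℝ

/-- The punctured space `ℝⁿ ∖ {0}` as a subset. [folklore] -/
def punctured (n : ℕ) : Set (RVec n) := {v | v ≠ 0}

/-- Membership in the punctured space. [folklore] -/
@[simp]
lemma mem_punctured {n : ℕ} (v : RVec n) : v ∈ punctured n ↔ v ≠ 0 := Iff.rfl

/-- The punctured space is open. [folklore] -/
lemma isOpen_punctured (n : ℕ) : IsOpen (punctured n) := isOpen_compl_singleton

/-! ### The slit decomposition `ℝᵏ⁺¹ ∖ {0} = A ∪ B` -/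

section Slit

variable (k : ℕ)

/-- `A = ℝᵏ⁺¹` minus the closed lower half of the last coordinate axis: vectors whose first `k`
coordinates are not all zero, or whose last coordinate is positive. [folklore] -/
def slitUp : Set (RVec (k + 1)) := {v | Fin.init v ≠ 0 ∨ 0 < v (Fin.last k)}

/-- `B = ℝᵏ⁺¹` minus the closed upper half of the last coordinate axis. [folklore] -/
def slitDown : Set (RVec (k + 1)) := {v | Fin.init v ≠ 0 ∨ v (Fin.last k) < 0}

/-- `Fin.init : ℝᵏ⁺¹ → ℝᵏ` is continuous. [folklore] -/
lemma continuous_finInit : Continuous (Fin.init : RVec (k + 1) → RVec k) :=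
  continuous_id.finInit

/-- `A` is open. [folklore] -/
lemma isOpen_slitUp : IsOpen (slitUp k) :=
  (isOpen_compl_singleton.preimage (continuous_finInit k)).union
    (isOpen_lt continuous_const (continuous_apply _))

/-- `B` is open. [folklore] -/
lemma isOpen_slitDown : IsOpen (slitDown k) :=
  (isOpen_compl_singleton.preimage (continuous_finInit k)).union
    (isOpen_lt (continuous_apply _) continuous_const)

/-- A vector vanishes iff its first `k` coordinates and its last coordinate vanish. [folklore] -/
lemma eq_zero_iff_init_last (v : RVec (k + 1)) : v = 0 ↔ Fin.init v = 0 ∧ v (Fin.last k) = 0 := by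
  constructor
  · rintro rfl
    exact ⟨rfl, rfl⟩
  · rintro ⟨h1, h2⟩
    rw [← Fin.snoc_init_self v, h1, h2]
    ext i
    refine Fin.lastCases ?_ (fun j => ?_) i <;> simp

/-- `A ∪ B = ℝᵏ⁺¹ ∖ {0}`. [folklore] -/
lemma slitUp_union_slitDown : slitUp k ∪ slitDown k = punctured (k + 1) := by
  ext v
  simp only [slitUp, slitDown, mem_union, mem_setOf_eq, mem_punctured, Ne,
    eq_zero_iff_init_last]
  constructor
  · rintro (⟨h | h⟩ | ⟨h | h⟩) ⟨h1, h2⟩ <;> simp_all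
  · intro h
    by_cases h1 : Fin.init v = 0
    · have h2 : v (Fin.last k) ≠ 0 := fun h2 => h ⟨h1, h2⟩
      rcases lt_or_gt_of_ne h2 with h2 | h2
      · exact Or.inr (Or.inr h2)
      · exact Or.inl (Or.inr h2)
    · exact Or.inl (Or.inl h1)

/-- `A ∩ B` is the set of vectors whose first `k` coordinates are not all zero. [folklore] -/
lemma slitUp_inter_slitDown : slitUp k ∩ slitDown k = {v | Fin.init v ≠ 0} := by
  ext v
  simp only [slitUp, slitDown, mem_inter_iff, mem_setOf_eq]
  constructor
  · rintro ⟨h | h, h' | h'⟩ <;> first | exact h | exact h' | exact absurd (h.trans h') (lt_irrefl _)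
  · intro h
    exact ⟨Or.inl h, Or.inl h⟩

/-- The point `(0, …, 0, 1)`. [folklore] -/
def northPt : RVec (k + 1) := Fin.snoc (0 : RVec k) 1

/-- The point `(0, …, 0, -1)`. [folklore] -/
def southPt : RVec (k + 1) := Fin.snoc (0 : RVec k) (-1)

/-- `A` is star-shaped about `(0, …, 0, 1)`. [folklore] -/
lemma starConvex_slitUp : StarConvex ℝ (northPt k) (slitUp k) := by
  intro v hv a b ha hb hab
  simp only [slitUp, mem_setOf_eq, northPt] at hv ⊢
  have hinit : Fin.init (a • (Fin.snoc (0 : RVec k) 1 : RVec (k + 1)) + b • v) = b • Fin.init v := by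
    ext i
    simp [Fin.init]
  have hlast : (a • (Fin.snoc (0 : RVec k) 1 : RVec (k + 1)) + b • v) (Fin.last k) =
      a + b * v (Fin.last k) := by
    simp
  rw [hinit, hlast]
  rcases hv with hv | hv
  · by_cases hb0 : b = 0
    · subst hb0
      right
      simp only [zero_mul, add_zero]
      linarith
    · left
      exact smul_ne_zero hb0 hv
  · rcases eq_or_lt_of_le ha with rfl | ha'
    · rw [zero_add] at hab
      subst hab
      right
      simpa using hv
    · right
      have : 0 ≤ b * v (Fin.last k) := mul_nonneg hb hv.le
      linarith

/-- `B` is star-shaped about `(0, …, 0, -1)`. [folklore] -/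
lemma starConvex_slitDown : StarConvex ℝ (southPt k) (slitDown k) := by
  intro v hv a b ha hb hab
  simp only [slitDown, mem_setOf_eq, southPt] at hv ⊢
  have hinit : Fin.init (a • (Fin.snoc (0 : RVec k) (-1) : RVec (k + 1)) + b • v) =
      b • Fin.init v := by
    ext i
    simp [Fin.init]
  have hlast : (a • (Fin.snoc (0 : RVec k) (-1) : RVec (k + 1)) + b • v) (Fin.last k) =
      -a + b * v (Fin.last k) := by
    simp
  rw [hinit, hlast]
  rcases hv with hv | hv
  · by_cases hb0 : b = 0
    · subst hb0
      right
      simp only [zero_mul, add_zero]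
      linarith
    · left
      exact smul_ne_zero hb0 hv
  · rcases eq_or_lt_of_le ha with rfl | ha'
    · rw [zero_add] at hab
      subst hab
      right
      simpa using hv
    · right
      have : b * v (Fin.last k) ≤ 0 := mul_nonpos_of_nonneg_of_nonpos hb hv.le
      linarith

/-- `A` is contractible (star-shaped and nonempty). [folklore] -/
theorem contractibleSpace_slitUp : ContractibleSpace (slitUp k) :=
  (starConvex_slitUp k).contractibleSpace ⟨northPt k, Or.inr (by simp [northPt])⟩

/-- `B` is contractible (star-shaped and nonempty). [folklore] -/
theorem contractibleSpace_slitDown : ContractibleSpace (slitDown k) :=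
  (starConvex_slitDown k).contractibleSpace ⟨southPt k, Or.inr (by simp [southPt])⟩

/-- Membership in `A ∩ B`. [folklore] -/
lemma mem_slitInter_iff (v : RVec (k + 1)) : v ∈ slitUp k ∩ slitDown k ↔ Fin.init v ≠ 0 := by
  rw [slitUp_inter_slitDown]
  rfl

/-! ### `A ∩ B ≃ₕ ℝᵏ ∖ {0}` -/

/-- The projection `A ∩ B → ℝᵏ ∖ {0}` forgetting the last coordinate. [folklore] -/
def slitInterProj : C(↥(slitUp k ∩ slitDown k), ↥(punctured k)) where
  toFun v := ⟨Fin.init v.1, (mem_slitInter_iff k v.1).mp v.2⟩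
  continuous_toFun := ((continuous_finInit k).comp continuous_subtype_val).subtype_mk _

/-- The embedding `ℝᵏ ∖ {0} → A ∩ B`, `w ↦ (w, 0)`. [folklore] -/
def slitInterEmb : C(↥(punctured k), ↥(slitUp k ∩ slitDown k)) where
  toFun w := ⟨Fin.snoc w.1 0, by
    rw [mem_slitInter_iff, Fin.init_snoc]
    exact w.2⟩
  continuous_toFun := by
    refine Continuous.subtype_mk ?_ _
    exact Continuous.finSnoc (A := fun _ : Fin (k + 1) => ℝ) continuous_subtype_val continuous_const

/-- The homotopy `(w, s·t)` between `(w, 0)` and `(w, t)` inside `A ∩ B`. [folklore] -/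
def slitInterHomotopy :
    ((slitInterEmb k).comp (slitInterProj k)).Homotopy (ContinuousMap.id _) where
  toFun p := ⟨Fin.snoc (Fin.init p.2.1) ((p.1 : ℝ) * p.2.1 (Fin.last k)), by
    rw [mem_slitInter_iff, Fin.init_snoc]
    exact (mem_slitInter_iff k _).mp p.2.2⟩
  continuous_toFun := by
    refine Continuous.subtype_mk ?_ _
    refine Continuous.finSnoc (A := fun _ : Fin (k + 1) => ℝ)
      ((continuous_finInit k).comp (continuous_subtype_val.comp continuous_snd)) ?_
    exact (continuous_subtype_val.comp continuous_fst).mul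
      ((continuous_apply _).comp (continuous_subtype_val.comp continuous_snd))
  map_zero_left v := by
    apply Subtype.ext
    simp only [ContinuousMap.comp_apply]
    change Fin.snoc (Fin.init v.1) ((0 : ℝ) * v.1 (Fin.last k)) = Fin.snoc (Fin.init v.1) 0
    rw [zero_mul]
  map_one_left v := by
    apply Subtype.ext
    change Fin.snoc (Fin.init v.1) ((1 : ℝ) * v.1 (Fin.last k)) = v.1
    rw [one_mul, Fin.snoc_init_self]

/-- **`A ∩ B ≃ₕ ℝᵏ ∖ {0}`**: forgetting the last coordinate is a homotopy equivalence from the doubly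
slit space onto the punctured hyperplane. [folklore] -/
def slitInterHomotopyEquiv : ↥(slitUp k ∩ slitDown k) ≃ₕ ↥(punctured k) where
  toFun := slitInterProj k
  invFun := slitInterEmb k
  left_inv := ⟨slitInterHomotopy k⟩
  right_inv := by
    have h : (slitInterProj k).comp (slitInterEmb k) = ContinuousMap.id _ := by
      ext w : 1
      apply Subtype.ext
      change Fin.init (Fin.snoc (α := fun _ : Fin (k + 1) => ℝ) w.1 0) = w.1
      rw [Fin.init_snoc]
    rw [h]

end Slit

/-! ### Complements of points and of star-shaped compact sets -/

section Complement

variable {n : ℕ}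

/-- `ℝⁿ ∖ {x} ≃ₜ ℝⁿ ∖ {0}` by translation. [folklore] -/
def complSingletonHomeomorph (x : RVec n) : ↥({x}ᶜ : Set (RVec n)) ≃ₜ ↥(punctured n) :=
  (Homeomorph.addRight (-x)).subtype fun v => by
    simp only [mem_compl_iff, mem_singleton_iff, Homeomorph.coe_addRight, mem_punctured, Ne,
      add_neg_eq_zero]

variable {K : Set (RVec n)} {x : RVec n}

/-- Points beyond a star-shaped set stay beyond it: if `x + t (v - x) ∈ K` for some `t ≥ 1` and `K`
is star-shaped about `x`, then `v ∈ K`. [folklore] -/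
lemma mem_of_smul_mem (hK : StarConvex ℝ x K) {v : RVec n} {t : ℝ} (ht : 1 ≤ t)
    (h : x + t • (v - x) ∈ K) : v ∈ K := by
  have ht0 : 0 < t := by linarith
  have key := hK h (a := 1 - t⁻¹) (b := t⁻¹) (by rw [sub_nonneg]; exact inv_le_one_of_one_le₀ ht)
    (by positivity) (by ring)
  have e : (1 - t⁻¹) • x + t⁻¹ • (x + t • (v - x)) = v := by
    rw [smul_add, smul_smul, inv_mul_cancel₀ ht0.ne', one_smul]
    module
  rwa [e] at key

variable (K x)

/-- The radial push-out `v ↦ x + max(1, ρ/‖v - x‖) (v - x)` of `ℝⁿ ∖ {x}` beyond radius `ρ`. [folklore] -/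
def pushOut (ρ : ℝ) (v : RVec n) : RVec n := x + max 1 (ρ / ‖v - x‖) • (v - x)

/-- The push-out is continuous away from `x`. [folklore] -/
lemma continuousOn_pushOut (ρ : ℝ) : ContinuousOn (pushOut x ρ) {x}ᶜ := by
  have hcoef : ContinuousOn (fun v : RVec n => max 1 (ρ / ‖v - x‖)) {x}ᶜ := by
    refine continuous_max.comp_continuousOn (continuousOn_const.prodMk
      (continuousOn_const.div ?_ fun v hv => ?_))
    · fun_prop
    · rw [norm_ne_zero_iff, sub_ne_zero]
      exact hv
  exact continuousOn_const.add (hcoef.smul (by fun_prop))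

/-- The push-out lands at distance `≥ ρ` from `x`. [folklore] -/
lemma le_norm_pushOut_sub (ρ : ℝ) {v : RVec n} (hv : v ≠ x) : ρ ≤ ‖pushOut x ρ v - x‖ := by
  have hvx : 0 < ‖v - x‖ := by rwa [norm_pos_iff, sub_ne_zero]
  rw [pushOut, add_sub_cancel_left, norm_smul, Real.norm_of_nonneg (by positivity)]
  calc ρ = ρ / ‖v - x‖ * ‖v - x‖ := by rw [div_mul_cancel₀ _ hvx.ne']
    _ ≤ max 1 (ρ / ‖v - x‖) * ‖v - x‖ := by gcongr; exact le_max_right _ _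

/-- The interpolation `x + ((1 - s) μ + s) (v - x)` between the push-out (`s = 0`) and `v` (`s = 1`),
where `μ = max(1, ρ/‖v - x‖) ≥ 1`. [folklore] -/
def pushOutHomotopyFun (ρ : ℝ) (p : I × RVec n) : RVec n :=
  x + ((1 - (p.1 : ℝ)) * max 1 (ρ / ‖p.2 - x‖) + (p.1 : ℝ)) • (p.2 - x)

/-- The interpolation coefficient is `≥ 1`. [folklore] -/
lemma one_le_pushOutCoeff (ρ : ℝ) (p : I × RVec n) :
    1 ≤ (1 - (p.1 : ℝ)) * max 1 (ρ / ‖p.2 - x‖) + (p.1 : ℝ) := by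
  have h1 : (0 : ℝ) ≤ 1 - p.1 := by linarith [p.1.2.2]
  nlinarith [le_max_left (1 : ℝ) (ρ / ‖p.2 - x‖), p.1.2.1]

/-- The interpolation is continuous away from `x`. [folklore] -/
lemma continuousOn_pushOutHomotopyFun (ρ : ℝ) :
    ContinuousOn (pushOutHomotopyFun x ρ) {p : I × RVec n | p.2 ≠ x} := by
  have hs : Continuous (fun p : I × RVec n => (p.1 : ℝ)) := continuous_subtype_val.comp continuous_fst
  have hcoef : ContinuousOn (fun p : I × RVec n => (1 - (p.1 : ℝ)) * max 1 (ρ / ‖p.2 - x‖) + (p.1 : ℝ))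
      {p : I × RVec n | p.2 ≠ x} := by
    refine (((continuous_const.sub hs).continuousOn).mul (continuous_max.comp_continuousOn
      (continuousOn_const.prodMk (continuousOn_const.div ?_ fun p hp => ?_)))).add hs.continuousOn
    · fun_prop
    · rw [norm_ne_zero_iff, sub_ne_zero]
      exact hp
  exact continuousOn_const.add (hcoef.smul (by fun_prop))

/-- The interpolated points avoid a star-shaped `K ∌ v` — in fact they avoid `x` and, when `v ∉ K`,
they avoid `K`. [folklore] -/
lemma pushOutHomotopyFun_not_mem (hK : StarConvex ℝ x K) (ρ : ℝ) (p : I × RVec n) (hv : p.2 ∉ K) :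
    pushOutHomotopyFun x ρ p ∉ K := fun h =>
  hv (mem_of_smul_mem hK (one_le_pushOutCoeff x ρ p) h)

/-- The interpolated points avoid `x`. [folklore] -/
lemma pushOutHomotopyFun_ne (ρ : ℝ) (p : I × RVec n) (hv : p.2 ≠ x) : pushOutHomotopyFun x ρ p ≠ x := by
  intro h
  rw [pushOutHomotopyFun, add_eq_left, smul_eq_zero, sub_eq_zero] at h
  rcases h with h | h
  · linarith [one_le_pushOutCoeff x ρ p]
  · exact hv h

variable {K x}

/-- A compact set lies within some radius of any point. [folklore] -/
lemma exists_forall_norm_sub_lt (hKc : IsCompact K) (x : RVec n) : ∃ ρ : ℝ, ∀ v ∈ K, ‖v - x‖ < ρ := by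
  obtain ⟨ρ, -, hρ⟩ := (hKc.image (continuous_id.sub continuous_const)).isBounded.subset_ball_lt 0 0
  exact ⟨ρ, fun v hv => by simpa using hρ (Set.mem_image_of_mem _ hv)⟩

/-- **The complement of a bounded star-shaped set is homotopy equivalent to the complement of its
centre** (Hatcher 2002, proof of Lemma 3.27 (2)): the inclusion `ℝⁿ ∖ K ↪ ℝⁿ ∖ {x}`, with homotopy
inverse the radial push-out beyond radius `ρ`. [folklore] -/
def complStarConvexHomotopyEquiv (hK : StarConvex ℝ x K) (hx : x ∈ K) (ρ : ℝ)
    (hρ : ∀ v ∈ K, ‖v - x‖ < ρ) : ↥(Kᶜ) ≃ₕ ↥({x}ᶜ : Set (RVec n)) := by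
  have hsub : K ᶜ ⊆ ({x}ᶜ : Set (RVec n)) := compl_subset_compl.mpr (singleton_subset_iff.mpr hx)
  have hpush : ∀ v : ↥({x}ᶜ : Set (RVec n)), pushOut x ρ v.1 ∈ Kᶜ := fun v h =>
    (lt_irrefl ρ) ((le_norm_pushOut_sub x ρ v.2).trans_lt (hρ _ h))
  exact
  { toFun := ⟨fun v => ⟨v.1, hsub v.2⟩, by fun_prop⟩
    invFun := ⟨fun v => ⟨pushOut x ρ v.1, hpush v⟩,
      ((continuousOn_pushOut x ρ).comp_continuous continuous_subtype_val fun v => v.2).subtype_mk _⟩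
    left_inv := ⟨
      { toFun := fun p => ⟨pushOutHomotopyFun x ρ (p.1, p.2.1),
          pushOutHomotopyFun_not_mem K x hK ρ _ p.2.2⟩
        continuous_toFun := ((continuousOn_pushOutHomotopyFun x ρ).comp_continuous
          (continuous_fst.prodMk (continuous_subtype_val.comp continuous_snd))
          fun p => hsub p.2.2).subtype_mk _
        map_zero_left := fun v => Subtype.ext (by
          simp [pushOutHomotopyFun, pushOut])
        map_one_left := fun v => Subtype.ext (by
          simp [pushOutHomotopyFun]) }⟩
    right_inv := ⟨
      { toFun := fun p => ⟨pushOutHomotopyFun x ρ (p.1, p.2.1), pushOutHomotopyFun_ne x ρ _ p.2.2⟩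
        continuous_toFun := ((continuousOn_pushOutHomotopyFun x ρ).comp_continuous
          (continuous_fst.prodMk (continuous_subtype_val.comp continuous_snd))
          fun p => p.2.2).subtype_mk _
        map_zero_left := fun v => Subtype.ext (by
          simp [pushOutHomotopyFun, pushOut])
        map_one_left := fun v => Subtype.ext (by
          simp [pushOutHomotopyFun]) }⟩ }

end Complement

/-! ### The Euclidean unit sphere is homotopy equivalent to punctured space -/

section Sphere

variable (n : ℕ)

/-- The coordinate map `EuclideanSpace ℝ (Fin n) ≃L[ℝ] (Fin n → ℝ)` (Mathlib's `EuclideanSpace.equiv`). [folklore] -/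
abbrev coords : EuclideanSpace ℝ (Fin n) ≃L[ℝ] RVec n := EuclideanSpace.equiv (Fin n) ℝ

/-- The unit sphere of `EuclideanSpace ℝ (Fin n)` (the `𝕊ⁿ⁻¹` of `Literature.Topology.FourManifolds.compactSpace_of_homotopyEquiv_sphere_four`). [folklore] -/
abbrev unitSphere : Set (EuclideanSpace ℝ (Fin n)) := Metric.sphere (0 : EuclideanSpace ℝ (Fin n)) 1

/-- Points of the unit sphere are nonzero. [folklore] -/
lemma ne_zero_of_mem_unitSphere {v : EuclideanSpace ℝ (Fin n)} (hv : v ∈ unitSphere n) : v ≠ 0 := by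
  rintro rfl
  simp at hv

/-- The coordinates of a point of the unit sphere are not all zero. [folklore] -/
lemma coords_mem_punctured (v : ↥(unitSphere n)) : coords n v.1 ∈ punctured n := by
  rw [mem_punctured, Ne, ← map_zero (coords n), (coords n).injective.eq_iff]
  exact ne_zero_of_mem_unitSphere n v.2

/-- The inclusion of the unit sphere into punctured coordinate space. [folklore] -/
def sphereToPunctured : C(↥(unitSphere n), ↥(punctured n)) where
  toFun v := ⟨coords n v.1, coords_mem_punctured n v⟩
  continuous_toFun := ((coords n).continuous.comp continuous_subtype_val).subtype_mk _

/-- The vector of `EuclideanSpace` with given (nonzero) coordinates is nonzero. [folklore] -/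
lemma coords_symm_ne_zero (w : ↥(punctured n)) : (coords n).symm w.1 ≠ 0 := by
  rw [Ne, ← map_zero (coords n).symm, (coords n).symm.injective.eq_iff]
  exact w.2

/-- The radial retraction of punctured coordinate space onto the unit sphere, `w ↦ w/‖w‖₂`. [folklore] -/
def puncturedToSphere : C(↥(punctured n), ↥(unitSphere n)) where
  toFun w := ⟨‖(coords n).symm w.1‖⁻¹ • (coords n).symm w.1, by
    rw [Metric.mem_sphere, dist_zero_right, norm_smul, norm_inv, norm_norm,
      inv_mul_cancel₀ (norm_ne_zero_iff.mpr (coords_symm_ne_zero n w))]⟩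
  continuous_toFun := by
    have h1 : Continuous fun w : ↥(punctured n) => (coords n).symm w.1 :=
      (coords n).symm.continuous.comp continuous_subtype_val
    have h2 : Continuous fun w : ↥(punctured n) => ‖(coords n).symm w.1‖⁻¹ :=
      Continuous.inv₀ (continuous_norm.comp h1) fun w => norm_ne_zero_iff.mpr (coords_symm_ne_zero n w)
    exact (h2.smul h1).subtype_mk _

/-- The straight-line homotopy `((1 - s)/‖w‖₂ + s) · w` in punctured space between the retraction
followed by the inclusion and the identity. [folklore] -/
def puncturedSphereHomotopy :
    ((sphereToPunctured n).comp (puncturedToSphere n)).Homotopy (ContinuousMap.id _) where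
  toFun p := ⟨((1 - (p.1 : ℝ)) * ‖(coords n).symm p.2.1‖⁻¹ + (p.1 : ℝ)) • p.2.1, by
    rw [mem_punctured]
    refine smul_ne_zero ?_ p.2.2
    have h1 : 0 < ‖(coords n).symm p.2.1‖⁻¹ := inv_pos.mpr (norm_pos_iff.mpr (coords_symm_ne_zero n p.2))
    have hs0 : (0 : ℝ) ≤ p.1 := p.1.2.1
    have hs1 : (p.1 : ℝ) ≤ 1 := p.1.2.2
    intro h
    rcases eq_or_lt_of_le hs0 with hs | hs
    · rw [← hs, sub_zero, one_mul, add_zero] at h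
      exact h1.ne' h
    · have : 0 ≤ (1 - (p.1 : ℝ)) * ‖(coords n).symm p.2.1‖⁻¹ := mul_nonneg (by linarith) h1.le
      linarith⟩
  continuous_toFun := by
    have hs : Continuous fun p : I × ↥(punctured n) => (p.1 : ℝ) := continuous_subtype_val.comp continuous_fst
    have h1 : Continuous fun p : I × ↥(punctured n) => ‖(coords n).symm p.2.1‖⁻¹ :=
      Continuous.inv₀ (continuous_norm.comp ((coords n).symm.continuous.comp
        (continuous_subtype_val.comp continuous_snd)))
        fun p => norm_ne_zero_iff.mpr (coords_symm_ne_zero n p.2)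
    have h2 : Continuous fun p : I × ↥(punctured n) =>
        (1 - (p.1 : ℝ)) * ‖(coords n).symm p.2.1‖⁻¹ + (p.1 : ℝ) := ((continuous_const.sub hs).mul h1).add hs
    exact (h2.smul (continuous_subtype_val.comp continuous_snd)).subtype_mk _
  map_zero_left w := by
    apply Subtype.ext
    change ((1 - (0 : ℝ)) * ‖(coords n).symm w.1‖⁻¹ + 0) • w.1 =
      coords n (‖(coords n).symm w.1‖⁻¹ • (coords n).symm w.1)
    rw [map_smul, ContinuousLinearEquiv.apply_symm_apply, sub_zero, one_mul, add_zero]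
  map_one_left w := by
    apply Subtype.ext
    change ((1 - (1 : ℝ)) * ‖(coords n).symm w.1‖⁻¹ + 1) • w.1 = w.1
    rw [sub_self, zero_mul, zero_add, one_smul]

/-- **The unit sphere `𝕊ⁿ⁻¹ ⊆ EuclideanSpace ℝ (Fin n)` is homotopy equivalent to `ℝⁿ ∖ {0}`**
(radial retraction). [folklore] -/
def sphereHomotopyEquivPunctured : ↥(unitSphere n) ≃ₕ ↥(punctured n) where
  toFun := sphereToPunctured n
  invFun := puncturedToSphere n
  left_inv := by
    have h : (puncturedToSphere n).comp (sphereToPunctured n) = ContinuousMap.id _ := by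
      ext v : 1
      apply Subtype.ext
      change ‖(coords n).symm (coords n v.1)‖⁻¹ • (coords n).symm (coords n v.1) = v.1
      have hv : ‖v.1‖ = 1 := by simpa only [Metric.mem_sphere, dist_zero_right] using v.2
      rw [ContinuousLinearEquiv.symm_apply_apply, hv, inv_one, one_smul]
    rw [h]
  right_inv := ⟨puncturedSphereHomotopy n⟩

end Sphere

end Literature.AlgebraicTopology.SingularHomology

end
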